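import Literature.Analysis.FluidPDE.CarlemanCommutator
import Literature.Analysis.FluidPDE.CarlemanFirst
import HarnessLib

/-!
# The anisotropic Carleman weight of Escauriaza–Seregin–Šverák (Seregin 2014, Prop. 1.3): derivative fields

Analysis/FluidPDE file in the backward-uniqueness track of the decomposition of **ns.S08**
`Literature.Analysis.FluidPDE.ess_endpoint`. The second Carleman inequality (Seregin 2014,
App. A.1, Prop. 1.3, (A.1.12); ESS 2003, §6) uses, on the shifted half-space
`(ℝⁿ₊ + eₙ) × ]0, 1[`, the weight
`φ = φ⁽¹⁾ + φ⁽²⁾`, `φ⁽¹⁾(x, t) = -|x'|²/(8t)`, `φ⁽²⁾(x, t) = a(1 - t) xₙ^{2α}/t^α`,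
`x = (x', xₙ)`, `α ∈ ]1/2, 1[`. Here physical space is a finite-dimensional real inner product
space `E` with a unit vector `eₙ` (`xₙ = ⟪x, eₙ⟫`, `|x'|² = |x|² - xₙ²`), and — to separate
calculus from the final inequalities — the factor `(1 - t)t^{-α} · xₙ^{2α}` is an arbitrary
product `k(t) ρ(xₙ)` of one-variable functions smooth on `]0, ∞[`:
`φ = -(|x|² - ⟪x,eₙ⟫²)/(8t) + a k(t) ρ(⟪x,eₙ⟫)` (`phiKR`), smooth on
`Ω = {t > 0} ∩ {⟪x, eₙ⟫ > 0}` (`halfDom`). We compute on `Ω` all the fields entering the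
commutator identity (A.1.6) (`FluidPDE/CarlemanCommutator`): `Dφ`, `∇ₓφ = -x'/(4t) + a k ρ' eₙ`
((A.1.13)), `|∇φ|² = |x'|²/(16t²) + a²k²ρ'²` ((A.1.14)), the Hessian
`φ_{e'e} = -(⟪e',e⟫ - ⟪e',eₙ⟫⟪e,eₙ⟫)/(4t) + a k ρ'' ⟪e,eₙ⟫⟪e',eₙ⟫` ((A.1.15)),
`Δφ = -(n-1)/(4t) + a k ρ''`, `Δ²φ = a k ρ⁗`, `∂ₜφ`, `∂ₜ²φ`, `∂ₜ|∇φ|²`, and the two contractions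
`Σ φᵢⱼφᵢφⱼ` ((A.1.16)) and `Σ φᵢⱼ⟪∂ⱼv, ∂ᵢv⟫ = -(|∇v|² - |∂ₙv|²)/(4t) + a k ρ''|∂ₙv|²`.

All statements are proved.

## References

* G. Seregin, *Lecture notes on regularity theory for the Navier–Stokes equations*, World
  Scientific 2014, Appendix A.1, Prop. 1.3, (A.1.13)–(A.1.18).
* L. Escauriaza, G. Seregin, V. Šverák, *`L_{3,∞}`-solutions of Navier–Stokes equations and
  backward uniqueness*, Russ. Math. Surveys 58:2 (2003), §6.
-/

noncomputable section

open MeasureTheory Set Function Filter Topology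
open scoped InnerProductSpace RealInnerProductSpace

namespace Literature.Analysis.FluidPDE

namespace Carleman

section SecondWeight

variable {E : Type*} [NormedAddCommGroup E] [InnerProductSpace ℝ E] [FiniteDimensional ℝ E]
  [MeasurableSpace E] [BorelSpace E]
variable {F : Type*} [NormedAddCommGroup F] [InnerProductSpace ℝ F]

/-- The open quarter-space `Ω = {t > 0} ∩ {⟪x, eₙ⟫ > 0}` on which the anisotropic weight is
smooth (the functions of Prop. 1.3 live in `(ℝⁿ₊ + eₙ) × ]0,1[ ⊆ Ω`). [cite: Seregin2014, App. A.1 Prop. 1.3] -/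
def halfDom (en : E) : Set (ℝ × E) := {z | 0 < z.1 ∧ 0 < ⟪z.2, en⟫}

/-- `φ⁽¹⁾(x, t) = -|x'|²/(8t)`, `|x'|² = |x|² - ⟪x, eₙ⟫²`. [cite: Seregin2014, App. A.1 Prop. 1.3] -/
def phi1 (en : E) (z : ℝ × E) : ℝ := -(‖z.2‖ ^ 2 - ⟪z.2, en⟫ ^ 2) / (8 * z.1)

/-- The anisotropic weight with a general separable second part:
`φ = -|x'|²/(8t) + a k(t) ρ(⟪x, eₙ⟫)` (Prop. 1.3: `k(t) = (1-t)t^{-α}`, `ρ(s) = s^{2α}`). [cite: Seregin2014, App. A.1 Prop. 1.3] -/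
def phiKR (a : ℝ) (k ρ : ℝ → ℝ) (en : E) (z : ℝ × E) : ℝ := phi1 en z + a * k z.1 * ρ ⟪z.2, en⟫

omit [FiniteDimensional ℝ E] [MeasurableSpace E] [BorelSpace E] in
/-- `Ω` is open. [folklore] -/
theorem isOpen_halfDom (en : E) : IsOpen (halfDom en) :=
  (isOpen_lt continuous_const continuous_fst).and
    (isOpen_lt continuous_const (continuous_snd.inner continuous_const))

/-! #### One-variable chain rules -/

omit [FiniteDimensional ℝ E] [MeasurableSpace E] [BorelSpace E] in
/-- `D(g(⟪x, c⟫))(z) v = g'(⟪x, c⟫) ⟪v.2, c⟫`. [folklore] -/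
theorem fderiv_comp_inner_snd_apply {g : ℝ → ℝ} (c : E) {z : ℝ × E}
    (hg : DifferentiableAt ℝ g ⟪z.2, c⟫) (v : ℝ × E) :
    fderiv ℝ (fun y : ℝ × E => g ⟪y.2, c⟫) z v = deriv g ⟪z.2, c⟫ * ⟪v.2, c⟫ := by
  have h2 : HasFDerivAt (fun y : ℝ × E => ⟪y.2, c⟫)
      ((innerSL ℝ c).comp (ContinuousLinearMap.snd ℝ ℝ E)) z := by
    have e : (fun y : ℝ × E => ⟪y.2, c⟫) =
        fun y => ((innerSL ℝ c).comp (ContinuousLinearMap.snd ℝ ℝ E)) y := by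
      funext y; simp [real_inner_comm]
    rw [e]; exact ContinuousLinearMap.hasFDerivAt _
  have h : HasFDerivAt (fun y : ℝ × E => g ⟪y.2, c⟫) _ z := hg.hasDerivAt.hasFDerivAt.comp z h2
  rw [h.fderiv]
  simp only [ContinuousLinearMap.comp_apply, ContinuousLinearMap.coe_snd', innerSL_apply_apply,
    real_inner_comm c, ContinuousLinearMap.toSpanSingleton_apply, smul_eq_mul]
  ring

variable {k ρ : ℝ → ℝ} (hk : ContDiffOn ℝ (⊤ : ℕ∞) k (Ioi 0)) (hρ : ContDiffOn ℝ (⊤ : ℕ∞) ρ (Ioi 0))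
include hk hρ

omit [NormedAddCommGroup E] [InnerProductSpace ℝ E] [FiniteDimensional ℝ E] [MeasurableSpace E]
  [BorelSpace E] hρ in
/-- Iterated derivatives of a function smooth on `]0, ∞[` are smooth there. [folklore] -/
theorem contDiffOn_iterate_deriv_Ioi (j : ℕ) : ContDiffOn ℝ (⊤ : ℕ∞) (deriv^[j] k) (Ioi 0) := by
  induction j with
  | zero => simpa using hk
  | succ j ih =>
    rw [Function.iterate_succ']
    exact ih.deriv_of_isOpen isOpen_Ioi le_rfl

omit [NormedAddCommGroup E] [InnerProductSpace ℝ E] [FiniteDimensional ℝ E] [MeasurableSpace E]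
  [BorelSpace E] hρ in
/-- Differentiability of the iterated derivatives at positive points. [folklore] -/
theorem differentiableAt_iterate_deriv (j : ℕ) {t : ℝ} (ht : 0 < t) :
    DifferentiableAt ℝ (deriv^[j] k) t :=
  ((contDiffOn_iterate_deriv_Ioi hk j).differentiableOn (by simp)).differentiableAt
    (isOpen_Ioi.mem_nhds ht)

omit [NormedAddCommGroup E] [InnerProductSpace ℝ E] [FiniteDimensional ℝ E] [MeasurableSpace E]
  [BorelSpace E] hk hρ in
/-- Differentiability at positive points of a function smooth on `]0, ∞[`. [folklore] -/
theorem differentiableAt_of_Ioi {f : ℝ → ℝ} (hf : ContDiffOn ℝ (⊤ : ℕ∞) f (Ioi 0)) {t : ℝ}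
    (ht : 0 < t) : DifferentiableAt ℝ f t :=
  (hf.differentiableOn (by simp)).differentiableAt (isOpen_Ioi.mem_nhds ht)

/-! #### Smoothness of the weight on `Ω` -/

omit [FiniteDimensional ℝ E] [MeasurableSpace E] [BorelSpace E] hk hρ in
/-- `φ⁽¹⁾ ∈ C^∞({t ≠ 0})`, in particular on `Ω`. [folklore] -/
theorem contDiffOn_phi1 (en : E) : ContDiffOn ℝ (⊤ : ℕ∞) (phi1 en) (halfDom en) := by
  have h1 : ContDiff ℝ (⊤ : ℕ∞) fun y : ℝ × E => -(‖y.2‖ ^ 2 - ⟪y.2, en⟫ ^ 2) :=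
    (contDiff_norm_sq_snd.sub ((contDiff_inner_snd_const en).pow 2)).neg
  refine h1.contDiffOn.div (contDiffOn_const.mul contDiffOn_fst) fun z hz => ?_
  exact mul_ne_zero (by norm_num) hz.1.ne'

omit [FiniteDimensional ℝ E] [MeasurableSpace E] [BorelSpace E] in
/-- `φ ∈ C^∞(Ω)`. [folklore] -/
theorem contDiffOn_phiKR (a : ℝ) (en : E) : ContDiffOn ℝ (⊤ : ℕ∞) (phiKR a k ρ en) (halfDom en) := by
  have h2 : ContDiffOn ℝ (⊤ : ℕ∞) (fun y : ℝ × E => k y.1) (halfDom en) :=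
    hk.comp contDiffOn_fst fun z hz => hz.1
  have h3 : ContDiffOn ℝ (⊤ : ℕ∞) (fun y : ℝ × E => ρ ⟪y.2, en⟫) (halfDom en) :=
    hρ.comp (contDiff_inner_snd_const en).contDiffOn fun z hz => hz.2
  unfold phiKR
  exact (contDiffOn_phi1 en).add ((contDiffOn_const.mul h2).mul h3)

/-! #### First derivatives ((A.1.13)) -/

omit [FiniteDimensional ℝ E] [MeasurableSpace E] [BorelSpace E] hk hρ in
/-- `Dφ⁽¹⁾(z)(v) = -(2⟪x, v.2⟫ - 2⟪x,eₙ⟫⟪v.2,eₙ⟫)/(8t) + (|x|² - ⟪x,eₙ⟫²)/(8t²) v.1` for `t ≠ 0`. [cite: Seregin2014, App. A.1 (A.1.13)] -/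
theorem fderiv_phi1_apply (en : E) {z : ℝ × E} (hz : 0 < z.1) (v : ℝ × E) :
    fderiv ℝ (phi1 en) z v =
      -(2 * ⟪z.2, v.2⟫ - 2 * ⟪z.2, en⟫ * ⟪v.2, en⟫) / (8 * z.1) +
        (‖z.2‖ ^ 2 - ⟪z.2, en⟫ ^ 2) / (8 * z.1 ^ 2) * v.1 := by
  -- `phi1 = N * g(t)` with `N = -(|x|² - ⟪x,eₙ⟫²)`, `g(t) = (8t)⁻¹`
  have h1 := hasFDerivAt_norm_sq_snd z
  have h2 : HasFDerivAt (fun y : ℝ × E => ⟪y.2, en⟫)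
      ((innerSL ℝ en).comp (ContinuousLinearMap.snd ℝ ℝ E)) z := by
    have e : (fun y : ℝ × E => ⟪y.2, en⟫) =
        fun y => ((innerSL ℝ en).comp (ContinuousLinearMap.snd ℝ ℝ E)) y := by
      funext y; simp [real_inner_comm]
    rw [e]; exact ContinuousLinearMap.hasFDerivAt _
  have hN : HasFDerivAt (fun y : ℝ × E => -(‖y.2‖ ^ 2 - ⟪y.2, en⟫ * ⟪y.2, en⟫)) _ z :=
    (h1.sub (h2.mul h2)).neg
  have hg : HasDerivAt (fun t : ℝ => (8 * t)⁻¹) (-(8 * 1) / (8 * id z.1) ^ 2) z.1 :=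
    ((hasDerivAt_id z.1).const_mul 8).inv (mul_ne_zero (by norm_num) hz.ne')
  have hg' : HasFDerivAt (fun y : ℝ × E => (8 * y.1)⁻¹)
      (((1 : ℝ →L[ℝ] ℝ).smulRight (-(8 * 1) / (8 * id z.1) ^ 2)).comp
        (ContinuousLinearMap.fst ℝ ℝ E)) z :=
    hg.hasFDerivAt.comp z hasFDerivAt_fst
  have e : phi1 en = fun y => -(‖y.2‖ ^ 2 - ⟪y.2, en⟫ * ⟪y.2, en⟫) * (8 * y.1)⁻¹ := by
    funext y; simp [phi1, div_eq_mul_inv, sq]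
  have hφ : HasFDerivAt (fun y : ℝ × E => -(‖y.2‖ ^ 2 - ⟪y.2, en⟫ * ⟪y.2, en⟫) * (8 * y.1)⁻¹) _ z :=
    hN.mul hg'
  rw [e, hφ.fderiv]
  simp only [_root_.add_apply, _root_.smul_apply, smul_eq_mul, _root_.neg_apply,
    _root_.sub_apply, ContinuousLinearMap.comp_apply,
    ContinuousLinearMap.smulRight_apply, one_apply_eq_self, ContinuousLinearMap.coe_fst',
    ContinuousLinearMap.coe_snd', ContinuousLinearMap.coe_id', innerSL_apply_apply, id,
    nsmul_eq_mul, Nat.cast_ofNat, real_inner_comm en]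
  field_simp
  ring

omit [FiniteDimensional ℝ E] [MeasurableSpace E] [BorelSpace E] in
/-- `Dφ(z)(v) = Dφ⁽¹⁾(z)(v) + a (k'(t) v.1 ρ(xₙ) + k(t) ρ'(xₙ) ⟪v.2, eₙ⟫)` on `Ω`. [cite: Seregin2014, App. A.1 (A.1.13)] -/
theorem fderiv_phiKR_apply (a : ℝ) (en : E) {z : ℝ × E} (hz : z ∈ halfDom en) (v : ℝ × E) :
    fderiv ℝ (phiKR a k ρ en) z v =
      -(2 * ⟪z.2, v.2⟫ - 2 * ⟪z.2, en⟫ * ⟪v.2, en⟫) / (8 * z.1) +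
        (‖z.2‖ ^ 2 - ⟪z.2, en⟫ ^ 2) / (8 * z.1 ^ 2) * v.1 +
      a * (deriv k z.1 * v.1 * ρ ⟪z.2, en⟫ + k z.1 * (deriv ρ ⟪z.2, en⟫ * ⟪v.2, en⟫)) := by
  have hkd : DifferentiableAt ℝ k z.1 := differentiableAt_iterate_deriv hk 0 hz.1
  have hρd : DifferentiableAt ℝ ρ ⟪z.2, en⟫ := differentiableAt_iterate_deriv hρ 0 hz.2
  have h1 : DifferentiableAt ℝ (phi1 en) z :=
    ((contDiffOn_phi1 en).differentiableOn (by simp)).differentiableAt ((isOpen_halfDom en).mem_nhds hz)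
  have h2 : DifferentiableAt ℝ (fun y : ℝ × E => k y.1) z := hkd.comp z differentiableAt_fst
  have h3 : DifferentiableAt ℝ (fun y : ℝ × E => ρ ⟪y.2, en⟫) z :=
    hρd.comp z ((contDiff_inner_snd_const en (n := 1)).differentiable one_ne_zero z)
  have h23 : DifferentiableAt ℝ (fun y : ℝ × E => a * k y.1) z := h2.const_mul a
  have h123 : DifferentiableAt ℝ (fun y : ℝ × E => a * k y.1 * ρ ⟪y.2, en⟫) z := h23.mul h3
  unfold phiKR
  rw [fderiv_fun_add h1 h123, fderiv_fun_mul h23 h3, fderiv_const_mul h2]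
  simp only [_root_.add_apply, _root_.smul_apply, smul_eq_mul, fderiv_phi1_apply en hz.1,
    fderiv_comp_fst_apply' hkd, fderiv_comp_inner_snd_apply en hρd]
  ring

omit [FiniteDimensional ℝ E] [MeasurableSpace E] [BorelSpace E] in
/-- `∂ₑφ = -(⟪x,e⟫ - ⟪x,eₙ⟫⟪e,eₙ⟫)/(4t) + a k ρ' ⟪e, eₙ⟫` on `Ω`. [cite: Seregin2014, App. A.1 (A.1.13)] -/
theorem dx_phiKR (a : ℝ) (en : E) {z : ℝ × E} (hz : z ∈ halfDom en) (e : E) :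
    dx e (phiKR a k ρ en) z =
      -(⟪z.2, e⟫ - ⟪z.2, en⟫ * ⟪e, en⟫) / (4 * z.1) + a * k z.1 * deriv ρ ⟪z.2, en⟫ * ⟪e, en⟫ := by
  rw [dx_apply, fderiv_phiKR_apply hk hρ a en hz]
  simp only [mul_zero, zero_mul, add_zero, zero_add]
  field_simp
  ring

omit [FiniteDimensional ℝ E] [MeasurableSpace E] [BorelSpace E] in
/-- `∂ₜφ = (|x|² - ⟪x,eₙ⟫²)/(8t²) + a k'(t) ρ(xₙ)` on `Ω`. [cite: Seregin2014, App. A.1 Prop. 1.3] -/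
theorem dt_phiKR (a : ℝ) (en : E) {z : ℝ × E} (hz : z ∈ halfDom en) :
    dt (phiKR a k ρ en) z =
      (‖z.2‖ ^ 2 - ⟪z.2, en⟫ ^ 2) / (8 * z.1 ^ 2) + a * deriv k z.1 * ρ ⟪z.2, en⟫ := by
  rw [dt_apply, fderiv_phiKR_apply hk hρ a en hz]
  simp only [inner_zero_right, inner_zero_left, mul_zero, sub_zero, zero_div, neg_zero,
    zero_add, mul_one]
  ring

omit [MeasurableSpace E] [BorelSpace E] in
/-- **(A.1.13)** `∇ₓφ = -x'/(4t) + a k ρ' eₙ`, `x' = x - ⟪x,eₙ⟫eₙ`, on `Ω`. [cite: Seregin2014, App. A.1 (A.1.13)] -/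
theorem gradX_phiKR (a : ℝ) (en : E) {z : ℝ × E} (hz : z ∈ halfDom en) :
    gradX (phiKR a k ρ en) z =
      (-(1 / (4 * z.1))) • (z.2 - ⟪z.2, en⟫ • en) + (a * k z.1 * deriv ρ ⟪z.2, en⟫) • en := by
  refine ext_inner_right ℝ fun e => ?_
  rw [inner_gradX, ← dx_apply, dx_phiKR hk hρ a en hz e, inner_add_left, real_inner_smul_left,
    real_inner_smul_left, inner_sub_left, real_inner_smul_left, real_inner_comm en e]
  field_simp

omit [MeasurableSpace E] [BorelSpace E] in
/-- **(A.1.14)** `|∇φ|² = |x'|²/(16t²) + a²k²ρ'²` (`∇φ⁽¹⁾ ⊥ ∇φ⁽²⁾`; `‖eₙ‖ = 1`), on `Ω`. [cite: Seregin2014, App. A.1 (A.1.14)] -/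
theorem norm_gradX_phiKR_sq (a : ℝ) {en : E} (hen : ‖en‖ = 1) {z : ℝ × E} (hz : z ∈ halfDom en) :
    ‖gradX (phiKR a k ρ en) z‖ ^ 2 =
      (‖z.2‖ ^ 2 - ⟪z.2, en⟫ ^ 2) / (16 * z.1 ^ 2) + (a * k z.1 * deriv ρ ⟪z.2, en⟫) ^ 2 := by
  have ht : z.1 ≠ 0 := hz.1.ne'
  have hee : ⟪en, en⟫ = 1 := by rw [real_inner_self_eq_norm_sq, hen, one_pow]
  rw [gradX_phiKR hk hρ a en hz, ← real_inner_self_eq_norm_sq]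
  simp only [inner_add_left, inner_add_right, inner_smul_left, inner_smul_right, inner_sub_left,
    inner_sub_right, real_inner_self_eq_norm_sq, hee, real_inner_comm en z.2, RCLike.conj_to_real]
  field_simp
  ring

/-! #### Two helper derivatives -/

omit [FiniteDimensional ℝ E] [MeasurableSpace E] [BorelSpace E] hk hρ in
/-- `D[(|x|² - ⟪x,eₙ⟫²)/(c t^m)](z) v = (2⟪x,v.2⟫ - 2⟪x,eₙ⟫⟪v.2,eₙ⟫)/(c t^m) - m (|x|² - ⟪x,eₙ⟫²)/(c t^{m+1}) v.1`
for `t ≠ 0`, `c ≠ 0`. [folklore] -/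
theorem fderiv_primeSq_div_apply (en : E) (c : ℝ) (hc : c ≠ 0) (m : ℕ) {z : ℝ × E} (hz : z.1 ≠ 0)
    (v : ℝ × E) :
    fderiv ℝ (fun y : ℝ × E => (‖y.2‖ ^ 2 - ⟪y.2, en⟫ ^ 2) / (c * y.1 ^ m)) z v =
      (2 * ⟪z.2, v.2⟫ - 2 * ⟪z.2, en⟫ * ⟪v.2, en⟫) / (c * z.1 ^ m) -
        m * (‖z.2‖ ^ 2 - ⟪z.2, en⟫ ^ 2) / (c * z.1 ^ (m + 1)) * v.1 := by
  have h1 := hasFDerivAt_norm_sq_snd z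
  have h2 : HasFDerivAt (fun y : ℝ × E => ⟪y.2, en⟫)
      ((innerSL ℝ en).comp (ContinuousLinearMap.snd ℝ ℝ E)) z := by
    have e : (fun y : ℝ × E => ⟪y.2, en⟫) =
        fun y => ((innerSL ℝ en).comp (ContinuousLinearMap.snd ℝ ℝ E)) y := by
      funext y; simp [real_inner_comm]
    rw [e]; exact ContinuousLinearMap.hasFDerivAt _
  have hN : HasFDerivAt (fun y : ℝ × E => ‖y.2‖ ^ 2 - ⟪y.2, en⟫ * ⟪y.2, en⟫) _ z := h1.sub (h2.mul h2)
  have hg : HasDerivAt (fun t : ℝ => (c * t ^ m)⁻¹) (-(c * (m * id z.1 ^ (m - 1) * 1)) / (c * id z.1 ^ m) ^ 2) z.1 :=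
    (((hasDerivAt_id z.1).pow m).const_mul c).inv (mul_ne_zero hc (pow_ne_zero _ hz))
  have hg' : HasFDerivAt (fun y : ℝ × E => (c * y.1 ^ m)⁻¹)
      (((1 : ℝ →L[ℝ] ℝ).smulRight (-(c * (m * id z.1 ^ (m - 1) * 1)) / (c * id z.1 ^ m) ^ 2)).comp
        (ContinuousLinearMap.fst ℝ ℝ E)) z :=
    hg.hasFDerivAt.comp z hasFDerivAt_fst
  have hφ : HasFDerivAt (fun y : ℝ × E => (‖y.2‖ ^ 2 - ⟪y.2, en⟫ * ⟪y.2, en⟫) * (c * y.1 ^ m)⁻¹) _ z :=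
    hN.mul hg'
  have e : (fun y : ℝ × E => (‖y.2‖ ^ 2 - ⟪y.2, en⟫ ^ 2) / (c * y.1 ^ m)) =
      fun y => (‖y.2‖ ^ 2 - ⟪y.2, en⟫ * ⟪y.2, en⟫) * (c * y.1 ^ m)⁻¹ := by
    funext y; simp [div_eq_mul_inv, sq]
  rw [e, hφ.fderiv]
  simp only [_root_.add_apply, _root_.smul_apply, smul_eq_mul, _root_.sub_apply,
    ContinuousLinearMap.comp_apply, ContinuousLinearMap.smulRight_apply, one_apply_eq_self,
    ContinuousLinearMap.coe_fst', ContinuousLinearMap.coe_snd', ContinuousLinearMap.coe_id',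
    innerSL_apply_apply, id, nsmul_eq_mul, Nat.cast_ofNat, real_inner_comm en]
  rcases Nat.eq_zero_or_pos m with hm | hm
  · subst hm
    simp
    field_simp
    ring
  · obtain ⟨j, rfl⟩ : ∃ j, m = j + 1 := ⟨m - 1, (Nat.sub_add_cancel hm).symm⟩
    simp only [Nat.add_sub_cancel, Nat.cast_add, Nat.cast_one]
    field_simp
    ring

omit [FiniteDimensional ℝ E] [MeasurableSpace E] [BorelSpace E] hk hρ in
/-- `D[f(t) g(⟪x,eₙ⟫)](z) v = f'(t) v.1 g(xₙ) + f(t) g'(xₙ) ⟪v.2, eₙ⟫`. [folklore] -/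
theorem fderiv_sep_apply {f g : ℝ → ℝ} (en : E) {z : ℝ × E} (hf : DifferentiableAt ℝ f z.1)
    (hg : DifferentiableAt ℝ g ⟪z.2, en⟫) (v : ℝ × E) :
    fderiv ℝ (fun y : ℝ × E => f y.1 * g ⟪y.2, en⟫) z v =
      deriv f z.1 * v.1 * g ⟪z.2, en⟫ + f z.1 * (deriv g ⟪z.2, en⟫ * ⟪v.2, en⟫) := by
  have h2 : DifferentiableAt ℝ (fun y : ℝ × E => f y.1) z := hf.comp z differentiableAt_fst
  have h3 : DifferentiableAt ℝ (fun y : ℝ × E => g ⟪y.2, en⟫) z :=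
    hg.comp z ((contDiff_inner_snd_const en (n := 1)).differentiable one_ne_zero z)
  rw [fderiv_fun_mul h2 h3]
  simp only [_root_.add_apply, _root_.smul_apply, smul_eq_mul, fderiv_comp_fst_apply' hf,
    fderiv_comp_inner_snd_apply en hg]
  ring

omit [FiniteDimensional ℝ E] [MeasurableSpace E] [BorelSpace E] hk hρ in
/-- `∂ₑ[f(t) g(xₙ)] = f(t) g'(xₙ) ⟪e, eₙ⟫` on `Ω` for `f, g ∈ C^∞(]0,∞[)`, as functions near
every point of `Ω`. [folklore] -/
theorem dx_sep_eventuallyEq {f g : ℝ → ℝ} (hf : ContDiffOn ℝ (⊤ : ℕ∞) f (Ioi 0))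
    (hg : ContDiffOn ℝ (⊤ : ℕ∞) g (Ioi 0)) (en : E) {z : ℝ × E} (hz : z ∈ halfDom en) (e : E) :
    dx e (fun y : ℝ × E => f y.1 * g ⟪y.2, en⟫) =ᶠ[𝓝 z]
      fun y => f y.1 * deriv g ⟪y.2, en⟫ * ⟪e, en⟫ := by
  filter_upwards [(isOpen_halfDom en).mem_nhds hz] with y hy
  rw [dx_apply, fderiv_sep_apply en (differentiableAt_of_Ioi hf hy.1) (differentiableAt_of_Ioi hg hy.2)]
  simp only [zero_mul, mul_zero, zero_add]
  ring

/-! #### The Hessian ((A.1.15)) and the Laplacians -/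

omit [FiniteDimensional ℝ E] [MeasurableSpace E] [BorelSpace E] in
/-- **(A.1.15)** the spatial Hessian on `Ω`:
`∂_{e'}∂ₑφ = -(⟪e',e⟫ - ⟪e',eₙ⟫⟪e,eₙ⟫)/(4t) + a k ρ''(xₙ) ⟪e,eₙ⟫⟪e',eₙ⟫`. [cite: Seregin2014, App. A.1 (A.1.15)] -/
theorem dx_dx_phiKR (a : ℝ) (en : E) {z : ℝ × E} (hz : z ∈ halfDom en) (e e' : E) :
    dx e' (dx e (phiKR a k ρ en)) z =
      -(⟪e', e⟫ - ⟪e', en⟫ * ⟪e, en⟫) / (4 * z.1) +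
        a * k z.1 * deriv^[2] ρ ⟪z.2, en⟫ * ⟪e, en⟫ * ⟪e', en⟫ := by
  -- `∂ₑφ` near `z`
  have hev : dx e (phiKR a k ρ en) =ᶠ[𝓝 z] fun y =>
      -(⟪y.2, e⟫ - ⟪y.2, en⟫ * ⟪e, en⟫) / (4 * y.1) +
        (a * ⟪e, en⟫) * k y.1 * deriv ρ ⟪y.2, en⟫ := by
    filter_upwards [(isOpen_halfDom en).mem_nhds hz] with y hy
    rw [dx_phiKR hk hρ a en hy e]
    ring
  rw [dx_apply, hev.fderiv_eq]
  -- the two summands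
  have h2 : ∀ c : E, HasFDerivAt (fun y : ℝ × E => ⟪y.2, c⟫)
      ((innerSL ℝ c).comp (ContinuousLinearMap.snd ℝ ℝ E)) z := by
    intro c
    have e : (fun y : ℝ × E => ⟪y.2, c⟫) =
        fun y => ((innerSL ℝ c).comp (ContinuousLinearMap.snd ℝ ℝ E)) y := by
      funext y; simp [real_inner_comm]
    rw [e]; exact ContinuousLinearMap.hasFDerivAt _
  have hL : HasFDerivAt (fun y : ℝ × E => -(⟪y.2, e⟫ - ⟪y.2, en⟫ * ⟪e, en⟫)) _ z :=
    ((h2 e).sub ((h2 en).mul_const ⟪e, en⟫)).neg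
  have hm : HasDerivAt (fun t : ℝ => (4 * t)⁻¹) (-(4 * 1) / (4 * id z.1) ^ 2) z.1 :=
    ((hasDerivAt_id z.1).const_mul 4).inv (mul_ne_zero (by norm_num) hz.1.ne')
  have hm' : HasFDerivAt (fun y : ℝ × E => (4 * y.1)⁻¹)
      (((1 : ℝ →L[ℝ] ℝ).smulRight (-(4 * 1) / (4 * id z.1) ^ 2)).comp
        (ContinuousLinearMap.fst ℝ ℝ E)) z :=
    hm.hasFDerivAt.comp z hasFDerivAt_fst
  have hG1 : HasFDerivAt (fun y : ℝ × E => -(⟪y.2, e⟫ - ⟪y.2, en⟫ * ⟪e, en⟫) * (4 * y.1)⁻¹) _ z :=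
    hL.mul hm'
  have hkd : DifferentiableAt ℝ k z.1 := differentiableAt_iterate_deriv hk 0 hz.1
  have hρd : DifferentiableAt ℝ (deriv ρ) ⟪z.2, en⟫ := by
    simpa using differentiableAt_iterate_deriv hρ 1 hz.2
  have hG2d : DifferentiableAt ℝ (fun y : ℝ × E => (a * ⟪e, en⟫) * k y.1 * deriv ρ ⟪y.2, en⟫) z := by
    have h2 : DifferentiableAt ℝ (fun y : ℝ × E => k y.1) z := hkd.comp z differentiableAt_fst
    have h3' := hρd.comp z ((contDiff_inner_snd_const en (n := 1)).differentiable one_ne_zero z)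
    have h3 : DifferentiableAt ℝ (fun y : ℝ × E => deriv ρ ⟪y.2, en⟫) z := h3'
    exact (h2.const_mul _).mul h3
  have e1 : (fun y : ℝ × E => -(⟪y.2, e⟫ - ⟪y.2, en⟫ * ⟪e, en⟫) / (4 * y.1) +
      (a * ⟪e, en⟫) * k y.1 * deriv ρ ⟪y.2, en⟫) =
      fun y => (fun y : ℝ × E => -(⟪y.2, e⟫ - ⟪y.2, en⟫ * ⟪e, en⟫) * (4 * y.1)⁻¹) y +
        (fun y : ℝ × E => (a * ⟪e, en⟫) * k y.1 * deriv ρ ⟪y.2, en⟫) y := by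
    funext y; simp [div_eq_mul_inv]
  rw [e1, fderiv_fun_add hG1.differentiableAt hG2d, _root_.add_apply, hG1.fderiv]
  have hsep : fderiv ℝ (fun y : ℝ × E => (a * ⟪e, en⟫) * k y.1 * deriv ρ ⟪y.2, en⟫) z (0, e') =
      (a * ⟪e, en⟫) * k z.1 * (deriv^[2] ρ ⟪z.2, en⟫ * ⟪e', en⟫) := by
    have h := fderiv_sep_apply (f := fun t => (a * ⟪e, en⟫) * k t) (g := deriv ρ) en (z := z)
      (hkd.const_mul _) hρd (0, e')
    simp only [zero_mul, mul_zero, zero_add] at h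
    rw [show (fun y : ℝ × E => (a * ⟪e, en⟫) * k y.1 * deriv ρ ⟪y.2, en⟫) =
      fun y => (fun t => (a * ⟪e, en⟫) * k t) y.1 * deriv ρ ⟪y.2, en⟫ from rfl, h]
    rfl
  rw [hsep]
  simp only [_root_.add_apply, _root_.smul_apply, smul_eq_mul, _root_.sub_apply, _root_.neg_apply,
    ContinuousLinearMap.comp_apply, ContinuousLinearMap.smulRight_apply, one_apply_eq_self,
    ContinuousLinearMap.coe_fst', ContinuousLinearMap.coe_snd', innerSL_apply_apply, id,
    real_inner_comm e e', real_inner_comm en e', mul_zero, zero_mul]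
  field_simp
  ring

omit [MeasurableSpace E] [BorelSpace E] in
/-- **`Δφ = -(n-1)/(4t) + a k ρ''(xₙ)`** on `Ω` (`Δφ⁽¹⁾ = -(n-1)/(4t)` as `|x'|²` has `n - 1`
directions; `‖eₙ‖ = 1`). [cite: Seregin2014, App. A.1 (A.1.15)] -/
theorem lap_phiKR (a : ℝ) {en : E} (hen : ‖en‖ = 1) {z : ℝ × E} (hz : z ∈ halfDom en) :
    lap (phiKR a k ρ en) z =
      -((Module.finrank ℝ E : ℝ) - 1) / (4 * z.1) + a * k z.1 * deriv^[2] ρ ⟪z.2, en⟫ := by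
  set b := stdOrthonormalBasis ℝ E with hb
  have hbb : ∀ i, ⟪b i, b i⟫ = 1 := fun i => by
    rw [real_inner_self_eq_norm_sq, b.orthonormal.1 i, one_pow]
  have hs : ∑ i, ⟪b i, en⟫ ^ 2 = 1 := by rw [b.sum_sq_inner_right en, hen, one_pow]
  have step : ∀ i, dx (b i) (dx (b i) (phiKR a k ρ en)) z =
      (1 / (4 * z.1) + a * k z.1 * deriv^[2] ρ ⟪z.2, en⟫) * ⟪b i, en⟫ ^ 2 + -(1 / (4 * z.1)) := by
    intro i
    rw [dx_dx_phiKR hk hρ a en hz (b i) (b i), hbb]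
    ring
  rw [lap, Finset.sum_congr rfl fun i _ => step i, Finset.sum_add_distrib, ← Finset.mul_sum, hs,
    Finset.sum_const, Finset.card_univ, Fintype.card_fin, nsmul_eq_mul]
  ring

omit [MeasurableSpace E] [BorelSpace E] hk hρ in
/-- The Laplacian depends only on the germ: `f = g` near `z` implies `Δf(z) = Δg(z)`. [folklore] -/
theorem lap_congr_of_eventuallyEq {f g : ℝ × E → F} {z : ℝ × E} (h : f =ᶠ[𝓝 z] g) :
    lap f z = lap g z := by
  have h1 : ∀ e : E, dx e f =ᶠ[𝓝 z] dx e g := fun e => by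
    filter_upwards [h.fderiv (𝕜 := ℝ)] with y hy
    rw [dx_apply, dx_apply, hy]
  unfold lap
  refine Finset.sum_congr rfl fun i _ => ?_
  rw [dx_apply, dx_apply, (h1 _).fderiv_eq]

omit [FiniteDimensional ℝ E] [MeasurableSpace E] [BorelSpace E] hk hρ in
/-- `∂ₑ∂ₑ[F(t) + f(t) g(xₙ)] = f(t) g''(xₙ) ⟪e,eₙ⟫²` on `Ω` for `F, f, g ∈ C^∞(]0,∞[)`. [folklore] -/
theorem dx_dx_sepAdd {Fz f g : ℝ → ℝ} (hF : ContDiffOn ℝ (⊤ : ℕ∞) Fz (Ioi 0))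
    (hf : ContDiffOn ℝ (⊤ : ℕ∞) f (Ioi 0)) (hg : ContDiffOn ℝ (⊤ : ℕ∞) g (Ioi 0)) (en : E)
    {z : ℝ × E} (hz : z ∈ halfDom en) (e : E) :
    dx e (dx e (fun y : ℝ × E => Fz y.1 + f y.1 * g ⟪y.2, en⟫)) z =
      f z.1 * deriv^[2] g ⟪z.2, en⟫ * ⟪e, en⟫ ^ 2 := by
  -- first derivative near `z`
  have hev : dx e (fun y : ℝ × E => Fz y.1 + f y.1 * g ⟪y.2, en⟫) =ᶠ[𝓝 z]
      fun y => (f y.1 * ⟪e, en⟫) * deriv g ⟪y.2, en⟫ := by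
    filter_upwards [(isOpen_halfDom en).mem_nhds hz] with y hy
    have hFd : DifferentiableAt ℝ Fz y.1 := differentiableAt_of_Ioi hF hy.1
    have hfd : DifferentiableAt ℝ f y.1 := differentiableAt_of_Ioi hf hy.1
    have hgd : DifferentiableAt ℝ g ⟪y.2, en⟫ := differentiableAt_of_Ioi hg hy.2
    have h1 : DifferentiableAt ℝ (fun y : ℝ × E => Fz y.1) y := hFd.comp y differentiableAt_fst
    have h2 : DifferentiableAt ℝ (fun y : ℝ × E => f y.1) y := hfd.comp y differentiableAt_fst
    have h3' := hgd.comp y ((contDiff_inner_snd_const en (n := 1)).differentiable one_ne_zero y)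
    have h3 : DifferentiableAt ℝ (fun y : ℝ × E => g ⟪y.2, en⟫) y := h3'
    have h23 : DifferentiableAt ℝ (fun y : ℝ × E => f y.1 * g ⟪y.2, en⟫) y := h2.mul h3
    rw [dx_apply, fderiv_fun_add h1 h23, _root_.add_apply, fderiv_comp_fst_apply' hFd,
      fderiv_sep_apply en hfd hgd]
    simp only [mul_zero, zero_mul, zero_add]
    ring
  rw [dx_apply, hev.fderiv_eq]
  have hfd : DifferentiableAt ℝ (fun t => f t * ⟪e, en⟫) z.1 := (differentiableAt_of_Ioi hf hz.1).mul_const _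
  have hgd : DifferentiableAt ℝ (deriv g) ⟪z.2, en⟫ := by
    simpa using differentiableAt_iterate_deriv hg 1 hz.2
  have h := fderiv_sep_apply (f := fun t => f t * ⟪e, en⟫) (g := deriv g) en (z := z) hfd hgd (0, e)
  rw [show (fun y : ℝ × E => f y.1 * ⟪e, en⟫ * deriv g ⟪y.2, en⟫) =
    fun y => (fun t => f t * ⟪e, en⟫) y.1 * deriv g ⟪y.2, en⟫ from rfl, h]
  simp only [mul_zero, zero_mul, zero_add]
  rw [show deriv (deriv g) ⟪z.2, en⟫ = deriv^[2] g ⟪z.2, en⟫ from rfl]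
  ring

omit [MeasurableSpace E] [BorelSpace E] hk hρ in
/-- `Δ[F(t) + f(t) g(xₙ)] = f(t) g''(xₙ)` on `Ω` (`‖eₙ‖ = 1`). [folklore] -/
theorem lap_sepAdd {Fz f g : ℝ → ℝ} (hF : ContDiffOn ℝ (⊤ : ℕ∞) Fz (Ioi 0))
    (hf : ContDiffOn ℝ (⊤ : ℕ∞) f (Ioi 0)) (hg : ContDiffOn ℝ (⊤ : ℕ∞) g (Ioi 0)) {en : E}
    (hen : ‖en‖ = 1) {z : ℝ × E} (hz : z ∈ halfDom en) :
    lap (fun y : ℝ × E => Fz y.1 + f y.1 * g ⟪y.2, en⟫) z = f z.1 * deriv^[2] g ⟪z.2, en⟫ := by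
  set b := stdOrthonormalBasis ℝ E with hb
  rw [lap, Finset.sum_congr rfl fun i _ => dx_dx_sepAdd hF hf hg en hz (b i), ← Finset.mul_sum,
    b.sum_sq_inner_right en, hen, one_pow, mul_one]

omit [MeasurableSpace E] [BorelSpace E] in
/-- **`Δ²φ = a k ρ⁗(xₙ)`** on `Ω` (`Δφ⁽¹⁾` is constant in `x`). [cite: Seregin2014, App. A.1 (A.1.15)] -/
theorem lap_lap_phiKR (a : ℝ) {en : E} (hen : ‖en‖ = 1) {z : ℝ × E} (hz : z ∈ halfDom en) :
    lap (lap (phiKR a k ρ en)) z = a * k z.1 * deriv^[4] ρ ⟪z.2, en⟫ := by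
  have hev : lap (phiKR a k ρ en) =ᶠ[𝓝 z] fun y =>
      (fun t => -((Module.finrank ℝ E : ℝ) - 1) / (4 * t)) y.1 + (fun t => a * k t) y.1 *
        (deriv^[2] ρ) ⟪y.2, en⟫ := by
    filter_upwards [(isOpen_halfDom en).mem_nhds hz] with y hy
    exact lap_phiKR hk hρ a hen hy
  have hF : ContDiffOn ℝ (⊤ : ℕ∞) (fun t : ℝ => -((Module.finrank ℝ E : ℝ) - 1) / (4 * t)) (Ioi 0) :=
    contDiffOn_const.div (contDiffOn_const.mul contDiffOn_id) fun t ht =>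
      mul_ne_zero (by norm_num) (ne_of_gt ht)
  have h2 := lap_sepAdd (Fz := fun t : ℝ => -((Module.finrank ℝ E : ℝ) - 1) / (4 * t))
    (f := fun t => a * k t) (g := deriv^[2] ρ) hF (contDiffOn_const.mul hk)
    (contDiffOn_iterate_deriv_Ioi hρ 2) hen hz
  rw [lap_congr_of_eventuallyEq hev, h2]
  show a * k z.1 * deriv^[2] (deriv^[2] ρ) ⟪z.2, en⟫ = a * k z.1 * deriv^[4] ρ ⟪z.2, en⟫
  rw [← Function.iterate_add_apply]

/-! #### Time derivatives -/

omit [FiniteDimensional ℝ E] [MeasurableSpace E] [BorelSpace E] in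
/-- **`∂ₜ²φ = -(|x|² - ⟪x,eₙ⟫²)/(4t³) + a k''(t) ρ(xₙ)`** on `Ω`. [cite: Seregin2014, App. A.1 Prop. 1.3] -/
theorem dt_dt_phiKR (a : ℝ) (en : E) {z : ℝ × E} (hz : z ∈ halfDom en) :
    dt (dt (phiKR a k ρ en)) z =
      -(‖z.2‖ ^ 2 - ⟪z.2, en⟫ ^ 2) / (4 * z.1 ^ 3) + a * deriv^[2] k z.1 * ρ ⟪z.2, en⟫ := by
  have hev : dt (phiKR a k ρ en) =ᶠ[𝓝 z] fun y =>
      (fun y : ℝ × E => (‖y.2‖ ^ 2 - ⟪y.2, en⟫ ^ 2) / (8 * y.1 ^ 2)) y +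
        (fun y : ℝ × E => (fun t => a * deriv k t) y.1 * ρ ⟪y.2, en⟫) y := by
    filter_upwards [(isOpen_halfDom en).mem_nhds hz] with y hy
    rw [dt_phiKR hk hρ a en hy]
  rw [dt_apply, hev.fderiv_eq]
  have hkd : DifferentiableAt ℝ (fun t => a * deriv k t) z.1 :=
    (by simpa using differentiableAt_iterate_deriv hk 1 hz.1 : DifferentiableAt ℝ (deriv k) z.1).const_mul a
  have hρd : DifferentiableAt ℝ ρ ⟪z.2, en⟫ := differentiableAt_of_Ioi hρ hz.2
  have h1 : DifferentiableAt ℝ (fun y : ℝ × E => (‖y.2‖ ^ 2 - ⟪y.2, en⟫ ^ 2) / (8 * y.1 ^ 2)) z := by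
    have hc : ContDiffOn ℝ (⊤ : ℕ∞) (fun y : ℝ × E => (‖y.2‖ ^ 2 - ⟪y.2, en⟫ ^ 2) / (8 * y.1 ^ 2))
        (halfDom en) :=
      (contDiff_norm_sq_snd.sub ((contDiff_inner_snd_const en).pow 2)).contDiffOn.div
        (contDiffOn_const.mul (contDiffOn_fst.pow 2)) fun y hy =>
          mul_ne_zero (by norm_num) (pow_ne_zero _ hy.1.ne')
    exact (hc.differentiableOn (by simp)).differentiableAt ((isOpen_halfDom en).mem_nhds hz)
  have h2 : DifferentiableAt ℝ (fun y : ℝ × E => (fun t => a * deriv k t) y.1 * ρ ⟪y.2, en⟫) z := by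
    have h3' := hρd.comp z ((contDiff_inner_snd_const en (n := 1)).differentiable one_ne_zero z)
    have h3 : DifferentiableAt ℝ (fun y : ℝ × E => ρ ⟪y.2, en⟫) z := h3'
    exact (hkd.comp z differentiableAt_fst).mul h3
  rw [fderiv_fun_add h1 h2, _root_.add_apply, fderiv_primeSq_div_apply en 8 (by norm_num) 2 hz.1.ne',
    fderiv_sep_apply en hkd hρd]
  have hd : deriv (fun t => a * deriv k t) z.1 = a * deriv^[2] k z.1 := by
    rw [deriv_const_mul _ (by simpa using differentiableAt_iterate_deriv hk 1 hz.1)]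
    rfl
  rw [hd]
  simp only [inner_zero_right, inner_zero_left, mul_zero, sub_zero, zero_div, mul_one, Nat.cast_ofNat]
  field_simp
  ring

omit [MeasurableSpace E] [BorelSpace E] in
/-- **`∂ₜ|∇φ|² = -(|x|² - ⟪x,eₙ⟫²)/(8t³) + 2 (a k ρ')(a k' ρ')`** on `Ω` (`‖eₙ‖ = 1`). [cite: Seregin2014, App. A.1 Prop. 1.3] -/
theorem dt_norm_gradX_phiKR_sq (a : ℝ) {en : E} (hen : ‖en‖ = 1) {z : ℝ × E} (hz : z ∈ halfDom en) :
    dt (fun y => ‖gradX (phiKR a k ρ en) y‖ ^ 2) z =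
      -(‖z.2‖ ^ 2 - ⟪z.2, en⟫ ^ 2) / (8 * z.1 ^ 3) +
        2 * (a * k z.1 * deriv ρ ⟪z.2, en⟫) * (a * deriv k z.1 * deriv ρ ⟪z.2, en⟫) := by
  have hev : (fun y => ‖gradX (phiKR a k ρ en) y‖ ^ 2) =ᶠ[𝓝 z] fun y =>
      (fun y : ℝ × E => (‖y.2‖ ^ 2 - ⟪y.2, en⟫ ^ 2) / (16 * y.1 ^ 2)) y +
        (fun y : ℝ × E => (fun t => (a * k t) ^ 2) y.1 * (fun s => deriv ρ s ^ 2) ⟪y.2, en⟫) y := by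
    filter_upwards [(isOpen_halfDom en).mem_nhds hz] with y hy
    rw [norm_gradX_phiKR_sq hk hρ a hen hy]
    ring
  rw [dt_apply, hev.fderiv_eq]
  have hkd : DifferentiableAt ℝ k z.1 := differentiableAt_of_Ioi hk hz.1
  have hk2 : DifferentiableAt ℝ (fun t => (a * k t) ^ 2) z.1 := (hkd.const_mul a).pow 2
  have hρ1 : DifferentiableAt ℝ (deriv ρ) ⟪z.2, en⟫ := by
    simpa using differentiableAt_iterate_deriv hρ 1 hz.2
  have hρ2 : DifferentiableAt ℝ (fun s => deriv ρ s ^ 2) ⟪z.2, en⟫ := hρ1.pow 2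
  have h1 : DifferentiableAt ℝ (fun y : ℝ × E => (‖y.2‖ ^ 2 - ⟪y.2, en⟫ ^ 2) / (16 * y.1 ^ 2)) z := by
    have hc : ContDiffOn ℝ (⊤ : ℕ∞) (fun y : ℝ × E => (‖y.2‖ ^ 2 - ⟪y.2, en⟫ ^ 2) / (16 * y.1 ^ 2))
        (halfDom en) :=
      (contDiff_norm_sq_snd.sub ((contDiff_inner_snd_const en).pow 2)).contDiffOn.div
        (contDiffOn_const.mul (contDiffOn_fst.pow 2)) fun y hy =>
          mul_ne_zero (by norm_num) (pow_ne_zero _ hy.1.ne')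
    exact (hc.differentiableOn (by simp)).differentiableAt ((isOpen_halfDom en).mem_nhds hz)
  have h2 : DifferentiableAt ℝ
      (fun y : ℝ × E => (fun t => (a * k t) ^ 2) y.1 * (fun s => deriv ρ s ^ 2) ⟪y.2, en⟫) z := by
    have h3' := hρ2.comp z ((contDiff_inner_snd_const en (n := 1)).differentiable one_ne_zero z)
    have h3 : DifferentiableAt ℝ (fun y : ℝ × E => (fun s => deriv ρ s ^ 2) ⟪y.2, en⟫) z := h3'
    exact (hk2.comp z differentiableAt_fst).mul h3
  rw [fderiv_fun_add h1 h2, _root_.add_apply, fderiv_primeSq_div_apply en 16 (by norm_num) 2 hz.1.ne',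
    fderiv_sep_apply en hk2 hρ2]
  have hd : deriv (fun t => (a * k t) ^ 2) z.1 = 2 * (a * k z.1) * (a * deriv k z.1) := by
    have h' : HasDerivAt (fun t => (a * k t) ^ 2) (2 * (a * k z.1) * (a * deriv k z.1)) z.1 :=
      ((hkd.hasDerivAt.const_mul a).pow 2).congr_deriv (by norm_num)
    exact h'.deriv
  rw [hd]
  simp only [inner_zero_right, inner_zero_left, mul_zero, sub_zero, zero_div, mul_one, Nat.cast_ofNat]
  field_simp
  ring

/-! #### The two contractions of the Hessian ((A.1.16)–(A.1.18)) -/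

omit [MeasurableSpace E] [BorelSpace E] hk hρ in
/-- Orthonormal contraction: `Σᵢ Σⱼ ⟪bᵢ, bⱼ⟫ P j i = Σᵢ P i i`. [folklore] -/
theorem sum_sum_inner_basis_mul (P : Fin (Module.finrank ℝ E) → Fin (Module.finrank ℝ E) → ℝ) :
    ∑ i, ∑ j, ⟪stdOrthonormalBasis ℝ E i, stdOrthonormalBasis ℝ E j⟫ * P j i = ∑ i, P i i := by
  classical
  set b := stdOrthonormalBasis ℝ E with hb
  refine Finset.sum_congr rfl fun i _ => ?_
  have h : ∀ j, ⟪b i, b j⟫ = if i = j then (1 : ℝ) else 0 := fun j =>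
    orthonormal_iff_ite.1 b.orthonormal i j
  simp_rw [h, ite_mul, one_mul, zero_mul]
  rw [Finset.sum_ite_eq]
  simp

omit [MeasurableSpace E] [BorelSpace E] hk hρ in
/-- `DV(0, eₙ) = Σⱼ ⟪bⱼ, eₙ⟫ ∂ⱼV`. [folklore] -/
theorem fderiv_apply_zero_eq_sum_smul {G : Type*} [NormedAddCommGroup G] [NormedSpace ℝ G]
    (W : ℝ × E → G) (z : ℝ × E) (en : E) :
    fderiv ℝ W z (0, en) = ∑ j, ⟪stdOrthonormalBasis ℝ E j, en⟫ • dx (stdOrthonormalBasis ℝ E j) W z := by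
  rw [prod_zero_eq_sum en, map_sum]
  refine Finset.sum_congr rfl fun j _ => ?_
  rw [map_smul, dx_apply, real_inner_comm]

omit [MeasurableSpace E] [BorelSpace E] in
/-- **The Hessian contracted with `∇v ⊗ ∇v`** ((A.1.17)–(A.1.18)): on `Ω`,
`Σᵢⱼ φᵢⱼ ⟪∂ⱼv, ∂ᵢv⟫ = -(|∇v|² - |∂ₙv|²)/(4t) + a k ρ''(xₙ) |∂ₙv|²`, `∂ₙv = Dv(0, eₙ)`
(no normalisation of `eₙ` is needed here). [cite: Seregin2014, App. A.1 (A.1.18)] -/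
theorem sum_hess_phiKR_inner (a : ℝ) (en : E) {z : ℝ × E} (hz : z ∈ halfDom en)
    (V : ℝ × E → F) :
    ∑ i, ∑ j, dx (stdOrthonormalBasis ℝ E i) (dx (stdOrthonormalBasis ℝ E j) (phiKR a k ρ en)) z *
        ⟪dx (stdOrthonormalBasis ℝ E j) V z, dx (stdOrthonormalBasis ℝ E i) V z⟫ =
      -(gradSq V z - ‖fderiv ℝ V z (0, en)‖ ^ 2) / (4 * z.1) +
        a * k z.1 * deriv^[2] ρ ⟪z.2, en⟫ * ‖fderiv ℝ V z (0, en)‖ ^ 2 := by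
  set b := stdOrthonormalBasis ℝ E with hb
  set c : ℝ := a * k z.1 * deriv^[2] ρ ⟪z.2, en⟫ with hc
  set P : Fin (Module.finrank ℝ E) → Fin (Module.finrank ℝ E) → ℝ :=
    fun j i => ⟪dx (b j) V z, dx (b i) V z⟫ with hP
  -- expand the Hessian
  have step : ∀ i j, dx (b i) (dx (b j) (phiKR a k ρ en)) z * ⟪dx (b j) V z, dx (b i) V z⟫ =
      (-(1 / (4 * z.1))) * (⟪b i, b j⟫ * P j i) +
        (1 / (4 * z.1) + c) * (⟪b i, en⟫ * ⟪b j, en⟫ * P j i) := by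
    intro i j
    rw [dx_dx_phiKR hk hρ a en hz (b j) (b i), hP, hc]
    field_simp
    ring
  have h1 : ∑ i, ∑ j, ⟪b i, b j⟫ * P j i = gradSq V z := by
    rw [sum_sum_inner_basis_mul]
    simp only [hP, real_inner_self_eq_norm_sq, gradSq]
    rfl
  have h2 : ∑ i, ∑ j, ⟪b i, en⟫ * ⟪b j, en⟫ * P j i = ‖fderiv ℝ V z (0, en)‖ ^ 2 := by
    rw [fderiv_apply_zero_eq_sum_smul, ← real_inner_self_eq_norm_sq, inner_sum]
    simp only [← hb]
    refine Finset.sum_congr rfl fun i _ => ?_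
    rw [sum_inner]
    refine Finset.sum_congr rfl fun j _ => ?_
    rw [real_inner_smul_left, real_inner_smul_right, hP]
    ring
  calc ∑ i, ∑ j, dx (b i) (dx (b j) (phiKR a k ρ en)) z * ⟪dx (b j) V z, dx (b i) V z⟫
      = ∑ i, ∑ j, ((-(1 / (4 * z.1))) * (⟪b i, b j⟫ * P j i) +
          (1 / (4 * z.1) + c) * (⟪b i, en⟫ * ⟪b j, en⟫ * P j i)) := by
        refine Finset.sum_congr rfl fun i _ => Finset.sum_congr rfl fun j _ => step i j
    _ = (-(1 / (4 * z.1))) * ∑ i, ∑ j, ⟪b i, b j⟫ * P j i +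
          (1 / (4 * z.1) + c) * ∑ i, ∑ j, ⟪b i, en⟫ * ⟪b j, en⟫ * P j i := by
        simp only [Finset.sum_add_distrib, Finset.mul_sum]
    _ = _ := by
        rw [h1, h2]
        field_simp
        ring

omit [MeasurableSpace E] [BorelSpace E] in
/-- **(A.1.16)** the Hessian contracted with `∇φ ⊗ ∇φ`: on `Ω`, `‖eₙ‖ = 1`,
`Σᵢⱼ φᵢⱼ φᵢ φⱼ = -|x'|²/(64t³) + a k ρ''(xₙ) (a k ρ'(xₙ))²`
(`= φ⁽¹⁾ᵢⱼφ⁽¹⁾ᵢφ⁽¹⁾ⱼ + φ⁽²⁾ᵢⱼφ⁽²⁾ᵢφ⁽²⁾ⱼ`). [cite: Seregin2014, App. A.1 (A.1.16)] -/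
theorem sum_hess_phiKR_grad (a : ℝ) {en : E} (hen : ‖en‖ = 1) {z : ℝ × E} (hz : z ∈ halfDom en) :
    ∑ i, ∑ j, dx (stdOrthonormalBasis ℝ E i) (dx (stdOrthonormalBasis ℝ E j) (phiKR a k ρ en)) z *
        dx (stdOrthonormalBasis ℝ E i) (phiKR a k ρ en) z * dx (stdOrthonormalBasis ℝ E j) (phiKR a k ρ en) z =
      -(‖z.2‖ ^ 2 - ⟪z.2, en⟫ ^ 2) / (64 * z.1 ^ 3) +
        a * k z.1 * deriv^[2] ρ ⟪z.2, en⟫ * (a * k z.1 * deriv ρ ⟪z.2, en⟫) ^ 2 := by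
  set b := stdOrthonormalBasis ℝ E with hb
  set c : ℝ := a * k z.1 * deriv^[2] ρ ⟪z.2, en⟫ with hc
  set g : E := gradX (phiKR a k ρ en) z with hg
  have hgi : ∀ i, dx (b i) (phiKR a k ρ en) z = ⟪g, b i⟫ := fun i => (inner_gradX_basis _ z i).symm
  have ht : z.1 ≠ 0 := hz.1.ne'
  have step : ∀ i j, dx (b i) (dx (b j) (phiKR a k ρ en)) z * dx (b i) (phiKR a k ρ en) z *
      dx (b j) (phiKR a k ρ en) z =
      (-(1 / (4 * z.1))) * (⟪b i, b j⟫ * (⟪g, b j⟫ * ⟪g, b i⟫)) +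
        (1 / (4 * z.1) + c) * ((⟪g, b i⟫ * ⟪b i, en⟫) * (⟪g, b j⟫ * ⟪b j, en⟫)) := by
    intro i j
    rw [dx_dx_phiKR hk hρ a en hz (b j) (b i), hgi, hgi, hc]
    field_simp
    ring
  have h1 : ∑ i, ∑ j, ⟪b i, b j⟫ * (⟪g, b j⟫ * ⟪g, b i⟫) = ‖g‖ ^ 2 := by
    rw [sum_sum_inner_basis_mul (P := fun j i => ⟪g, b j⟫ * ⟪g, b i⟫), ← b.sum_sq_inner_left g]
    simp [sq]
  have h2 : ∑ i, ∑ j, (⟪g, b i⟫ * ⟪b i, en⟫) * (⟪g, b j⟫ * ⟪b j, en⟫) = ⟪g, en⟫ ^ 2 := by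
    rw [← Finset.sum_mul_sum, b.sum_inner_mul_inner g en, sq]
  have hge : ⟪g, en⟫ = a * k z.1 * deriv ρ ⟪z.2, en⟫ := by
    have hee : ⟪en, en⟫ = 1 := by rw [real_inner_self_eq_norm_sq, hen, one_pow]
    rw [hg, gradX_phiKR hk hρ a en hz, inner_add_left, real_inner_smul_left, real_inner_smul_left,
      inner_sub_left, real_inner_smul_left, hee]
    ring
  have hgn : ‖g‖ ^ 2 = (‖z.2‖ ^ 2 - ⟪z.2, en⟫ ^ 2) / (16 * z.1 ^ 2) + (a * k z.1 * deriv ρ ⟪z.2, en⟫) ^ 2 :=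
    norm_gradX_phiKR_sq hk hρ a hen hz
  calc ∑ i, ∑ j, dx (b i) (dx (b j) (phiKR a k ρ en)) z * dx (b i) (phiKR a k ρ en) z *
        dx (b j) (phiKR a k ρ en) z
      = ∑ i, ∑ j, ((-(1 / (4 * z.1))) * (⟪b i, b j⟫ * (⟪g, b j⟫ * ⟪g, b i⟫)) +
          (1 / (4 * z.1) + c) * ((⟪g, b i⟫ * ⟪b i, en⟫) * (⟪g, b j⟫ * ⟪b j, en⟫))) := by
        refine Finset.sum_congr rfl fun i _ => Finset.sum_congr rfl fun j _ => step i j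
    _ = (-(1 / (4 * z.1))) * ∑ i, ∑ j, ⟪b i, b j⟫ * (⟪g, b j⟫ * ⟪g, b i⟫) +
          (1 / (4 * z.1) + c) * ∑ i, ∑ j, (⟪g, b i⟫ * ⟪b i, en⟫) * (⟪g, b j⟫ * ⟪b j, en⟫) := by
        simp only [Finset.sum_add_distrib, Finset.mul_sum]
    _ = _ := by
        rw [h1, h2, hge, hgn]
        field_simp
        ring

end SecondWeight

end Carleman

end Literature.Analysis.FluidPDE
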